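import Mathlib
import HarnessLib

/-!
# Independence number of a Cartesian product: Vizing's bounds and Klavžar's partition bound

Source: Imrich–Klavžar–Rall, *Topics in Graph Theory: Graphs and Their Cartesian Product*
(A K Peters 2008), Chapter 7 "Independence": the product lower bound `α(G □ H) ≥ α(G)α(H)`
(§7.2, display preceding Proposition 7.1), Vizing's Proposition 7.1
`α(G □ H) ≥ α(G)α(H) + min{|G| − α(G), |H| − α(H)}` (Vizing 1963), Klavžar's Theorem 7.4
`α(G □ H) ≤ Σᵢ α(G □ Hᵢ)` for a vertex partition `{Vᵢ}` of `H` with `Hᵢ = H[Vᵢ]` (Klavžar 2005),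
and Corollary 7.5 (i) `α(G □ H) ≤ min{α(G)|H|, α(H)|G|}` (Vizing 1963).

Everything is stated over Mathlib's `SimpleGraph.boxProd` (`□`), `SimpleGraph.indepNum`,
`SimpleGraph.IsIndepSet` and `SimpleGraph.induce`; no definitions are introduced. The partition in
Theorem 7.4 is presented as the fibres `{w | f w = i}` of a labelling `f : W → ι`.

* `isIndepSet_product` / `mul_indepNum_le_indepNum_boxProd` — `I × J` is independent in `G □ H`;
  `α(G)α(H) ≤ α(G □ H)` (IKR §7.2).
* `vizing_lower_bound` — Proposition 7.1.
* `card_filter_snd_le_indepNum`, `indepNum_boxProd_le_indepNum_mul_card`,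
  `indepNum_boxProd_le_card_mul_indepNum`, `indepNum_boxProd_le_min` — an independent set meets
  each fibre `V × {w}` in at most `α(G)` vertices (and each `{v} × W` in at most `α(H)`);
  Corollary 7.5 (i).
* `indepNum_boxProd_le_sum_indepNum_boxProd_induce` — Theorem 7.4.
* Instance: `α(K₂ □ K₂) = 2` (`= α(C₄)`), showing Proposition 7.1 (`1·1 + min{1,1} = 2`) and
  Corollary 7.5 (i) (`min{1·2, 1·2} = 2`) are both tight there.
-/

namespace Literature.Combinatorics.SimpleGraph.IndependenceBoxProd

open Finset _root_.SimpleGraph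

variable {V W : Type*} {G : SimpleGraph V} {H : SimpleGraph W}

/-! ## Lower bounds (IKR §7.2) -/

/-- [cite: ImrichKlavzarRall2008, Section 7.2 ("if I is an independent subset of G, and J is
independent in H, then I × J is independent in G □ H")]
The product of independent sets is independent in the Cartesian product. -/
theorem isIndepSet_product {I : Set V} {J : Set W} (hI : G.IsIndepSet I) (hJ : H.IsIndepSet J) :
    (G □ H).IsIndepSet (I ×ˢ J) := by
  rintro ⟨a, b⟩ ⟨ha, hb⟩ ⟨c, d⟩ ⟨hc, hd⟩ hne h
  rcases boxProd_adj.1 h with ⟨hadj, hbd⟩ | ⟨hadj, hac⟩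
  · exact hI ha hc hadj.ne hadj
  · exact hJ hb hd hadj.ne hadj

/-- [cite: ImrichKlavzarRall2008, Section 7.2 (display: α(G □ H) ≥ α(G)α(H)); Vizing1963]
`α(G) · α(H) ≤ α(G □ H)`. -/
theorem mul_indepNum_le_indepNum_boxProd [Finite V] [Finite W] :
    G.indepNum * H.indepNum ≤ (G □ H).indepNum := by
  classical
  obtain ⟨I, hI⟩ := G.exists_isNIndepSet_indepNum
  obtain ⟨J, hJ⟩ := H.exists_isNIndepSet_indepNum
  have hS : (G □ H).IsIndepSet ↑(I ×ˢ J) := by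
    rw [coe_product]
    exact isIndepSet_product hI.isIndepSet hJ.isIndepSet
  rw [← hI.card_eq, ← hJ.card_eq, ← card_product]
  exact hS.card_le_indepNum

/-- [cite: ImrichKlavzarRall2008, Proposition 7.1; Vizing1963]
**Vizing's lower bound.** `α(G □ H) ≥ α(G)α(H) + min{|G| − α(G), |H| − α(H)}`: to `I × J` one may
add a "diagonal" of pairs `(gᵢ, hᵢ)` with distinct `gᵢ ∉ I` and distinct `hᵢ ∉ J`. -/
theorem vizing_lower_bound [Fintype V] [Fintype W] :
    G.indepNum * H.indepNum +
        min (Fintype.card V - G.indepNum) (Fintype.card W - H.indepNum) ≤ (G □ H).indepNum := by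
  classical
  obtain ⟨I, hI⟩ := G.exists_isNIndepSet_indepNum
  obtain ⟨J, hJ⟩ := H.exists_isNIndepSet_indepNum
  set r := min (Fintype.card V - G.indepNum) (Fintype.card W - H.indepNum) with hr
  have hAex : r ≤ (univ \ I).card := by
    rw [card_sdiff_of_subset (subset_univ I), card_univ, hI.card_eq]; exact min_le_left _ _
  have hBex : r ≤ (univ \ J).card := by
    rw [card_sdiff_of_subset (subset_univ J), card_univ, hJ.card_eq]; exact min_le_right _ _
  obtain ⟨A, hA, hAcard⟩ := exists_subset_card_eq hAex
  obtain ⟨B, hB, hBcard⟩ := exists_subset_card_eq hBex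
  have hAI : ∀ a ∈ A, a ∉ I := fun a ha => (mem_sdiff.1 (hA ha)).2
  have hBJ : ∀ b ∈ B, b ∉ J := fun b hb => (mem_sdiff.1 (hB hb)).2
  -- a bijection between `A` and `B` (both have `r` elements)
  have hcardAB : Fintype.card ↥A = Fintype.card ↥B := by simp [hAcard, hBcard]
  let e : ↥A ≃ ↥B := Fintype.equivOfCardEq hcardAB
  let D : Finset (V × W) := A.attach.image (fun a : ↥A => ((a : V), ((e a : ↥B) : W)))
  have hDmem : ∀ p ∈ D, p.1 ∈ A ∧ p.2 ∈ B := by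
    intro p hp
    obtain ⟨a, -, rfl⟩ := mem_image.1 hp
    exact ⟨a.2, (e a).2⟩
  have hDcard : D.card = r := by
    have hinj : Function.Injective (fun a : ↥A => ((a : V), ((e a : ↥B) : W))) :=
      fun a₁ a₂ h => Subtype.ext (Prod.ext_iff.1 h).1
    rw [card_image_of_injective _ hinj, card_attach, hAcard]
  -- two distinct diagonal points differ in both coordinates
  have hDdiag : ∀ p ∈ D, ∀ q ∈ D, p ≠ q → p.1 ≠ q.1 ∧ p.2 ≠ q.2 := by
    intro p hp q hq hne
    obtain ⟨a₁, -, rfl⟩ := mem_image.1 hp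
    obtain ⟨a₂, -, rfl⟩ := mem_image.1 hq
    have hne' : a₁ ≠ a₂ := fun h => hne (by rw [h])
    refine ⟨fun h => hne' (Subtype.ext h), fun h => hne' (e.injective (Subtype.ext h))⟩
  have hdisj : Disjoint (I ×ˢ J) D := by
    rw [Finset.disjoint_left]
    intro p hp hpD
    exact hAI _ (hDmem p hpD).1 (mem_product.1 hp).1
  have hS : (G □ H).IsIndepSet ↑(I ×ˢ J ∪ D) := by
    intro p hp q hq hne h
    rw [mem_coe, mem_union] at hp hq
    rcases hp with hp | hp <;> rcases hq with hq | hq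
    · exact isIndepSet_product hI.isIndepSet hJ.isIndepSet
        (by rw [← coe_product]; exact mem_coe.2 hp) (by rw [← coe_product]; exact mem_coe.2 hq)
        hne h
    · rcases boxProd_adj.1 h with ⟨-, h2⟩ | ⟨-, h1⟩
      · exact hBJ _ (hDmem q hq).2 (h2 ▸ (mem_product.1 hp).2)
      · exact hAI _ (hDmem q hq).1 (h1 ▸ (mem_product.1 hp).1)
    · rcases boxProd_adj.1 h with ⟨-, h2⟩ | ⟨-, h1⟩
      · exact hBJ _ (hDmem p hp).2 (h2.symm ▸ (mem_product.1 hq).2)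
      · exact hAI _ (hDmem p hp).1 (h1.symm ▸ (mem_product.1 hq).1)
    · rcases boxProd_adj.1 h with ⟨-, h2⟩ | ⟨-, h1⟩
      · exact (hDdiag p hp q hq hne).2 h2
      · exact (hDdiag p hp q hq hne).1 h1
  calc G.indepNum * H.indepNum + r = (I ×ˢ J ∪ D).card := by
        rw [card_union_of_disjoint hdisj, card_product, hI.card_eq, hJ.card_eq, hDcard]
    _ ≤ (G □ H).indepNum := hS.card_le_indepNum

/-! ## Upper bounds by fibres (IKR §7.3) -/

/-- [cite: ImrichKlavzarRall2008, Section 7.3 (proof of Corollary 7.5 (i)); Vizing1963]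
An independent set of `G □ H` meets the fibre `V × {w}` in (the graph of) an independent set of
`G`, hence in at most `α(G)` vertices. -/
theorem card_filter_snd_le_indepNum [Fintype V] [DecidableEq V] [DecidableEq W]
    {S : Finset (V × W)} (hS : (G □ H).IsIndepSet ↑S) (w : W) :
    (S.filter fun p => p.2 = w).card ≤ G.indepNum := by
  have hT : G.IsIndepSet ↑((S.filter fun p => p.2 = w).image Prod.fst) := by
    intro a ha b hb hne hadj
    rw [mem_coe, mem_image] at ha hb
    obtain ⟨p, hp, rfl⟩ := ha
    obtain ⟨q, hq, rfl⟩ := hb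
    rw [mem_filter] at hp hq
    refine hS (mem_coe.2 hp.1) (mem_coe.2 hq.1) (fun h => hne (by rw [h]))
      (boxProd_adj.2 (Or.inl ⟨hadj, by rw [hp.2, hq.2]⟩))
  have hinj : Set.InjOn (Prod.fst : V × W → V) (↑(S.filter fun p => p.2 = w) : Set (V × W)) := by
    intro p hp q hq h
    rw [mem_coe, mem_filter] at hp hq
    exact Prod.ext h (by rw [hp.2, hq.2])
  rw [← card_image_of_injOn hinj]
  exact hT.card_le_indepNum

/-- [cite: ImrichKlavzarRall2008, Section 7.3 (proof of Corollary 7.5 (i)); Vizing1963]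
Symmetrically, an independent set of `G □ H` meets the fibre `{v} × W` in at most `α(H)`
vertices. -/
theorem card_filter_fst_le_indepNum [Fintype W] [DecidableEq V] [DecidableEq W]
    {S : Finset (V × W)} (hS : (G □ H).IsIndepSet ↑S) (v : V) :
    (S.filter fun p => p.1 = v).card ≤ H.indepNum := by
  have hT : H.IsIndepSet ↑((S.filter fun p => p.1 = v).image Prod.snd) := by
    intro a ha b hb hne hadj
    rw [mem_coe, mem_image] at ha hb
    obtain ⟨p, hp, rfl⟩ := ha
    obtain ⟨q, hq, rfl⟩ := hb
    rw [mem_filter] at hp hq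
    refine hS (mem_coe.2 hp.1) (mem_coe.2 hq.1) (fun h => hne (by rw [h]))
      (boxProd_adj.2 (Or.inr ⟨hadj, by rw [hp.2, hq.2]⟩))
  have hinj : Set.InjOn (Prod.snd : V × W → W) (↑(S.filter fun p => p.1 = v) : Set (V × W)) := by
    intro p hp q hq h
    rw [mem_coe, mem_filter] at hp hq
    exact Prod.ext (by rw [hp.2, hq.2]) h
  rw [← card_image_of_injOn hinj]
  exact hT.card_le_indepNum

/-- [cite: ImrichKlavzarRall2008, Corollary 7.5 (i); Vizing1963]
`α(G □ H) ≤ α(G) · |H|`. -/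
theorem indepNum_boxProd_le_indepNum_mul_card [Fintype V] [Fintype W] :
    (G □ H).indepNum ≤ G.indepNum * Fintype.card W := by
  classical
  obtain ⟨S, hS⟩ := (G □ H).exists_isNIndepSet_indepNum
  rw [← hS.card_eq, card_eq_sum_card_fiberwise (f := Prod.snd) (t := (univ : Finset W))
    (fun p _ => mem_coe.2 (mem_univ _))]
  calc ∑ w ∈ (univ : Finset W), (S.filter fun p => p.2 = w).card
      ≤ ∑ _w ∈ (univ : Finset W), G.indepNum :=
        sum_le_sum fun w _ => card_filter_snd_le_indepNum hS.isIndepSet w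
    _ = G.indepNum * Fintype.card W := by rw [sum_const, card_univ, smul_eq_mul, mul_comm]

/-- [cite: ImrichKlavzarRall2008, Corollary 7.5 (i); Vizing1963]
`α(G □ H) ≤ |G| · α(H)`. -/
theorem indepNum_boxProd_le_card_mul_indepNum [Fintype V] [Fintype W] :
    (G □ H).indepNum ≤ Fintype.card V * H.indepNum := by
  classical
  obtain ⟨S, hS⟩ := (G □ H).exists_isNIndepSet_indepNum
  rw [← hS.card_eq, card_eq_sum_card_fiberwise (f := Prod.fst) (t := (univ : Finset V))
    (fun p _ => mem_coe.2 (mem_univ _))]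
  calc ∑ v ∈ (univ : Finset V), (S.filter fun p => p.1 = v).card
      ≤ ∑ _v ∈ (univ : Finset V), H.indepNum :=
        sum_le_sum fun v _ => card_filter_fst_le_indepNum hS.isIndepSet v
    _ = Fintype.card V * H.indepNum := by rw [sum_const, card_univ, smul_eq_mul]

/-- [cite: ImrichKlavzarRall2008, Corollary 7.5 (i); Vizing1963]
**Vizing's upper bound.** `α(G □ H) ≤ min{α(G)|H|, α(H)|G|}`. -/
theorem indepNum_boxProd_le_min [Fintype V] [Fintype W] :
    (G □ H).indepNum ≤ min (G.indepNum * Fintype.card W) (Fintype.card V * H.indepNum) :=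
  le_min indepNum_boxProd_le_indepNum_mul_card indepNum_boxProd_le_card_mul_indepNum

/-! ## Klavžar's partition bound (IKR Theorem 7.4) -/

/-- [cite: ImrichKlavzarRall2008, Theorem 7.4 (proof idea: restrict an independent set to
G □ H[Vᵢ]); Klavzar2005]
The part of an independent set of `G □ H` lying over a vertex class `T ⊆ W` is (the image of) an
independent set of `G □ H[T]`, hence has at most `α(G □ H[T])` vertices. -/
theorem card_filter_mem_le_indepNum_induce [Fintype V] [Fintype W] [DecidableEq V]
    [DecidableEq W] {S : Finset (V × W)} (hS : (G □ H).IsIndepSet ↑S) (T : Set W)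
    [DecidablePred (· ∈ T)] :
    (S.filter fun p => p.2 ∈ T).card ≤ (G □ H.induce T).indepNum := by
  classical
  -- pull the filtered set back to `V × T`
  let S' : Finset (V × T) := univ.filter fun q => ((q.1, (q.2 : W)) : V × W) ∈ S
  have hS' : (G □ H.induce T).IsIndepSet ↑S' := by
    intro q hq q' hq' hne h
    rw [mem_coe, mem_filter] at hq hq'
    have hne' : ((q.1, (q.2 : W)) : V × W) ≠ (q'.1, (q'.2 : W)) := by
      intro heq
      apply hne
      obtain ⟨h1, h2⟩ := Prod.ext_iff.1 heq
      exact Prod.ext h1 (Subtype.ext h2)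
    refine hS (mem_coe.2 hq.2) (mem_coe.2 hq'.2) hne' (boxProd_adj.2 ?_)
    rcases boxProd_adj.1 h with ⟨hadj, h2⟩ | ⟨hadj, h1⟩
    · exact Or.inl ⟨hadj, by simp only [h2]⟩
    · exact Or.inr ⟨induce_adj.1 hadj, h1⟩
  have hcard : (S.filter fun p => p.2 ∈ T).card = S'.card := by
    refine card_bij (fun p hp => (p.1, ⟨p.2, (mem_filter.1 hp).2⟩)) ?_ ?_ ?_
    · intro p hp
      exact mem_filter.2 ⟨mem_univ _, (mem_filter.1 hp).1⟩
    · intro p₁ hp₁ p₂ hp₂ h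
      obtain ⟨h1, h2⟩ := Prod.ext_iff.1 h
      exact Prod.ext h1 (congrArg Subtype.val h2)
    · intro q hq
      rw [mem_filter] at hq
      exact ⟨(q.1, (q.2 : W)), mem_filter.2 ⟨hq.2, q.2.2⟩, rfl⟩
  rw [hcard]
  exact hS'.card_le_indepNum

/-- [cite: ImrichKlavzarRall2008, Theorem 7.4; Klavzar2005]
**Klavžar's partition bound.** For a labelling `f : W → ι` of the vertices of `H` with finitely
many labels (the partition `{Vᵢ} = {f⁻¹(i)}` and `Hᵢ = H[Vᵢ]`):
`α(G □ H) ≤ Σᵢ α(G □ H[f⁻¹(i)])`. -/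
theorem indepNum_boxProd_le_sum_indepNum_boxProd_induce [Fintype V] [Fintype W] {ι : Type*}
    [Fintype ι] [DecidableEq ι] (f : W → ι) :
    (G □ H).indepNum ≤ ∑ i, (G □ H.induce {w | f w = i}).indepNum := by
  classical
  obtain ⟨S, hS⟩ := (G □ H).exists_isNIndepSet_indepNum
  rw [← hS.card_eq, card_eq_sum_card_fiberwise (f := fun p : V × W => f p.2)
    (t := (univ : Finset ι)) (fun p _ => mem_coe.2 (mem_univ _))]
  refine sum_le_sum fun i _ => ?_
  exact card_filter_mem_le_indepNum_induce hS.isIndepSet {w | f w = i}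

/-! ## Instance: `K₂ □ K₂ = C₄` -/

/-- [cite: ImrichKlavzarRall2008, Proposition 7.1 and Corollary 7.5 (i) (instance: both bounds
give α(K₂ □ K₂) = 2, since α(K₂) = 1)]
`α(K₂ □ K₂) = 2`. -/
theorem indepNum_top_two_boxProd_top_two :
    ((⊤ : SimpleGraph (Fin 2)) □ (⊤ : SimpleGraph (Fin 2))).indepNum = 2 := by
  have hK2 : (⊤ : SimpleGraph (Fin 2)).indepNum = 1 := by
    apply le_antisymm
    · obtain ⟨S, hS⟩ := (⊤ : SimpleGraph (Fin 2)).exists_isNIndepSet_indepNum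
      rw [← hS.card_eq]
      refine Finset.card_le_one.2 fun a ha b hb => ?_
      by_contra hab
      exact hS.isIndepSet (mem_coe.2 ha) (mem_coe.2 hb) hab ((top_adj a b).2 hab)
    · have h1 : (⊤ : SimpleGraph (Fin 2)).IsIndepSet ↑({0} : Finset (Fin 2)) := by
        rw [coe_singleton]; exact Set.pairwise_singleton _ _
      simpa using h1.card_le_indepNum
  apply le_antisymm
  · have h := (indepNum_boxProd_le_indepNum_mul_card
      (G := (⊤ : SimpleGraph (Fin 2))) (H := (⊤ : SimpleGraph (Fin 2))))
    rw [hK2, Fintype.card_fin] at h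
    simpa using h
  · have h := (vizing_lower_bound (G := (⊤ : SimpleGraph (Fin 2))) (H := (⊤ : SimpleGraph (Fin 2))))
    rw [hK2, Fintype.card_fin] at h
    simpa using h

end Literature.Combinatorics.SimpleGraph.IndependenceBoxProd
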